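import Summits.AtomisticToContinuum.HydrodynamicLimit.Theorems.TwoClocksEquilibriumFastWindowLDBirthT12TrueSlice
import HarnessLib

/-!
# The TRUE one-step gain term on a GENERAL test function, II: the circle geometry of the slice image and the
# gain term as a `(τ, x)`-average of CIRCLE integrals at one radius
# (helpers `t12_trueSlice_circle`, `t12_gainTerm_true_circleAvg` of the line `birth`, crux
# `TwoClocks.EquilibriumFastWindowLD`, stmt-AtomisticToContinuum-14440; §6 of the corrector-growth plan via SLICES,
# step (1), towards the registered analytic sub-goal `t12_logLinearPreimage_and_dipoleModulus`)

Continuation of `…T12TrueSlice` (`t12_gainTerm_true_slice`: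
`gainTerm u (S n) = 2 ∫ γ(dτ) ∫_{-1}^{1} (S x - τ)₊ ∫_{-π}^{π} u(v'(τ, x, φ)) dφ dx`,
`v'(τ, x, φ) = S n - (S x - τ) ω(x, φ)`, `ω(x, φ) = x n + √(1-x²)(cos φ e₁ n + sin φ e₂ n)`). Here the IMAGE CIRCLE
is identified. With the flux variable `c = S x - τ`:

* `v'(τ, x, φ) = (S - c x) n - c√(1-x²)(cos φ e₁ n + sin φ e₂ n)`, so the height `⟪v', n⟫ = S - c x` and the speed
  `‖v'‖² = S² - (S x)² + τ²` do not depend on the azimuth: as `φ` varies, `v'` runs over the circle of the sphere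
  of radius **`r(x, τ) = √(S² - (S x)² + τ²)`** about the axis `n` at cosine **`ρ(x, τ) = (S - (S x - τ) x)/r(x, τ)`**
  (`trueSlice_radius_cosine`: `r² = S²(1 - x²) + τ²`, `r ρ = S - (S x - τ) x`, `|ρ| ≤ 1` — since
  `r² - (S - c x)² = c²(1 - x²) ≥ 0`), with azimuth `φ + π` when `c > 0` (transverse part `-c√(1-x²) = -r√(1-ρ²)`)
  and `φ` when `c ≤ 0`.
* Hence (`circleIntegral_trueSlice_of_sq_eq`, `circleIntegral_trueSlice`; registered **`t12_trueSlice_circle`**),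
  for EVERY `u : ℝ³ → ℝ` (no measurability: the azimuth flip `φ ↦ φ + π` is a full-period shift of a `2π`-periodic
  integrand, `intervalIntegral_comp_neg_cos_sin`),
  `∫_{-π}^{π} u(v'(τ, x, φ)) dφ = ∫_{-π}^{π} u( r [ρ n + √(1-ρ²)(cos φ e₁ n + sin φ e₂ n)] ) dφ = 2π (A_ρ u(r ·))(n)`,
  the circle integral of `u` on the sphere of radius `r` at cosine `ρ` about `n` (circle averages `A_ρ` of FACT F).
* Whence (`gainTerm_true_eq_circle`; registered **`t12_gainTerm_true_circleAvg`**): for `u` measurable of Gaussian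
  growth, unit `n`, real `S`,
  `gainTerm u (S n) = 2 ∫ γ(dτ) ∫_{-1}^{1} (S x - τ)₊ ∫_{-π}^{π} u( r(x,τ) [ρ(x,τ) n + √(1-ρ(x,τ)²)(cos φ e₁ n + sin φ e₂ n)] ) dφ dx`
  — the true collision step is an average over `(τ, x)` (weights `γ(dτ) (S x - τ)₊ dx`) of CIRCLE AVERAGES of `u`
  at ONE radius `r(x, τ)` with a zonal angular operator `A_{ρ(x,τ)}`, exactly as the Lorentz step; and the slice
  `τ = 0` is FACT F verbatim (`lorentzGain_true_eq_circle_zero`: radius `S z`, cosine `z = √(1-x²)`,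
  flux `(S x)₊ dx` versus `t12_lorentzGain_circleAvg`'s `πS · 4z (2π)⁻¹ dz = 2S z dz` under `x dx = -z dz`;
  the equality of the two numbers is `trueSlice_zero_eq_lorentzCircleAvg`).
* Geometry for the iteration (`inner_and_norm_sq_trueSlice_point`): for unit `n`, `⟪n, v'⟫ = S - (S x - τ) x` and
  `‖v'‖² = S² - (S x)² + τ²`; the circle point `ρ n + √(1-ρ²)(cos φ e₁ n + sin φ e₂ n)` is a unit vector
  (`norm_cylPoint`), so the next true step applies to `v' = r · (unit vector)` with `(S, n) ← (r, circle point)`.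

[folklore] (elementary geometry of one hard-sphere collision, Cercignani–Illner–Pulvirenti 1994 §3.1; Carleman 1933;
step (1) of §6 of the corrector-growth plan of the line `birth`).
-/

noncomputable section

open MeasureTheory ProbabilityTheory Real Set Filter Metric
open scoped ENNReal BigOperators InnerProductSpace
namespace Summit.AtomisticToContinuum.HydrodynamicLimit.Theorems.ClampedCorrectorBirth

open Literature.Analysis.FluidPDE Literature.MathematicalPhysics.KineticTheory
open Literature.Analysis.UnboundedOperators Literature.Probability.Distributions

variable {u : EuclideanSpace ℝ (Fin 3) → ℝ} {C : ℝ} {n : EuclideanSpace ℝ (Fin 3)}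

/-! ### The azimuth flip, Bochner form -/

/-- **The azimuth flip `φ ↦ φ + π`, Bochner form**: `∫_{-π}^{π} g(-cos φ, -sin φ) dφ = ∫_{-π}^{π} g(cos φ, sin φ) dφ`
for EVERY `g` (Banach values, no integrability): the integrand `φ ↦ g(cos φ, sin φ)` is `2π`-periodic and
`(cos, sin)(φ + π) = -(cos, sin)(φ)`, so this is the shift of a full period (`Function.Periodic.intervalIntegral_add_eq`;
`lintegral` form `lintegral_Ioc_cos_sin_antipodal` in `…T12SphereCyl`). [folklore] -/
theorem intervalIntegral_comp_neg_cos_sin {G : Type*} [NormedAddCommGroup G] [NormedSpace ℝ G] (g : ℝ → ℝ → G) :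
    ∫ φ in (-π)..π, g (-cos φ) (-sin φ) = ∫ φ in (-π)..π, g (cos φ) (sin φ) := by
  have h1 : (fun φ => g (-cos φ) (-sin φ)) = fun φ => (fun ψ => g (cos ψ) (sin ψ)) (φ + π) := by
    funext φ
    simp only [cos_add_pi, sin_add_pi]
  have hp : Function.Periodic (fun ψ => g (cos ψ) (sin ψ)) (2 * π) := fun ψ => by
    simp only [cos_add_two_pi, sin_add_two_pi]
  rw [h1, intervalIntegral.integral_comp_add_right (fun ψ => g (cos ψ) (sin ψ)) π, neg_add_cancel,
    show π + π = 0 + 2 * π by ring, hp.intervalIntegral_add_eq 0 (-π), show -π + 2 * π = π by ring]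

/-! ### The circle geometry of the slice image -/

/-- **Height and speed of the slice image are azimuth-free**: for unit `n`, `x² ≤ 1` and reals `S, τ, φ`, the point
`v' = S n - (S x - τ)(x n + √(1-x²)(cos φ e₁ n + sin φ e₂ n))` has `⟪n, v'⟫ = S - (S x - τ) x` and
`‖v'‖² = S² - (S x)² + τ²` (`⟪n, ω(x, φ)⟫ = x`, `‖ω(x, φ)‖ = 1`): it lies on the circle of the sphere of radius
`r = √(S² - (S x)² + τ²)` at cosine `(S - (S x - τ) x)/r` about `n`. [folklore] -/
theorem inner_and_norm_sq_trueSlice_point (hn : ‖n‖ = 1) {x : ℝ} (hx : x ^ 2 ≤ 1) (S τ φ : ℝ) :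
    ⟪n, S • n - (S * x - τ) • (x • n + √(1 - x ^ 2) • (cos φ • Lambert.e₁ n + sin φ • Lambert.e₂ n))⟫_ℝ =
        S - (S * x - τ) * x ∧
      ‖S • n - (S * x - τ) • (x • n + √(1 - x ^ 2) • (cos φ • Lambert.e₁ n + sin φ • Lambert.e₂ n))‖ ^ 2 =
        S ^ 2 - (S * x) ^ 2 + τ ^ 2 := by
  have h1 := inner_self_cylPoint hn x φ
  have h2 := norm_cylPoint hn hx φ
  have hnn : ⟪n, n⟫_ℝ = 1 := by rw [real_inner_self_eq_norm_sq, hn, one_pow]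
  refine ⟨?_, ?_⟩
  · rw [inner_sub_right, inner_smul_right, inner_smul_right, hnn, h1]
    ring
  · rw [norm_sub_sq_real, real_inner_smul_left, real_inner_smul_right, h1, norm_smul, norm_smul, hn, h2,
      Real.norm_eq_abs, Real.norm_eq_abs, mul_one, mul_one, sq_abs, sq_abs]
    ring

/-- **The slice image runs over a circle (characterisation by `r², rρ`)**: for every `u : ℝ³ → ℝ`, every `n`,
reals `S, x, τ` with `x² ≤ 1`, and `r ≥ 0`, `ρ` with `r² = S² - (S x)² + τ²`, `r ρ = S - (S x - τ) x`, `ρ² ≤ 1`: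
`∫_{-π}^{π} u(S n - (S x - τ)(x n + √(1-x²)(cos φ e₁ n + sin φ e₂ n))) dφ = ∫_{-π}^{π} u(r [ρ n + √(1-ρ²)(cos φ e₁ n + sin φ e₂ n)]) dφ`.
Proof: `S n - c ω(x, φ) = (S - c x) n - c√(1-x²)(cos φ e₁ + sin φ e₂)`, `c = S x - τ`, and `r√(1-ρ²) = |c|√(1-x²)`
(`r²(1-ρ²) = r² - (rρ)² = c²(1-x²)`); for `c ≤ 0` the two integrands agree, for `c > 0` after the azimuth flip
`intervalIntegral_comp_neg_cos_sin`. [folklore] -/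
theorem circleIntegral_trueSlice_of_sq_eq (u : EuclideanSpace ℝ (Fin 3) → ℝ) (n : EuclideanSpace ℝ (Fin 3))
    {S x τ r ρ : ℝ} (hx : x ^ 2 ≤ 1) (hr : 0 ≤ r) (hr2 : r ^ 2 = S ^ 2 - (S * x) ^ 2 + τ ^ 2)
    (hrρ : r * ρ = S - (S * x - τ) * x) (hρ : ρ ^ 2 ≤ 1) :
    ∫ φ in (-π)..π, u (S • n - (S * x - τ) • (x • n + √(1 - x ^ 2) • (cos φ • Lambert.e₁ n + sin φ • Lambert.e₂ n))) =
      ∫ φ in (-π)..π, u (r • (ρ • n + √(1 - ρ ^ 2) • (cos φ • Lambert.e₁ n + sin φ • Lambert.e₂ n))) := by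
  -- the transverse magnitude
  have hT : r * √(1 - ρ ^ 2) = |S * x - τ| * √(1 - x ^ 2) := by
    have h1 : 0 ≤ r * √(1 - ρ ^ 2) := mul_nonneg hr (sqrt_nonneg _)
    have h2 : 0 ≤ |S * x - τ| * √(1 - x ^ 2) := mul_nonneg (abs_nonneg _) (sqrt_nonneg _)
    refine (pow_left_inj₀ h1 h2 two_ne_zero).1 ?_
    rw [mul_pow, mul_pow, sq_sqrt (by linarith), sq_sqrt (by linarith), sq_abs]
    calc r ^ 2 * (1 - ρ ^ 2) = r ^ 2 - (r * ρ) ^ 2 := by ring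
      _ = (S ^ 2 - (S * x) ^ 2 + τ ^ 2) - (S - (S * x - τ) * x) ^ 2 := by rw [hr2, hrρ]
      _ = (S * x - τ) ^ 2 * (1 - x ^ 2) := by ring
  -- the decomposition of the image point along `n` and transversally
  have hv' : ∀ φ : ℝ, S • n - (S * x - τ) • (x • n + √(1 - x ^ 2) • (cos φ • Lambert.e₁ n + sin φ • Lambert.e₂ n)) =
      (r * ρ) • n + (-((S * x - τ) * √(1 - x ^ 2))) • (cos φ • Lambert.e₁ n + sin φ • Lambert.e₂ n) := fun φ => by
    rw [hrρ]
    module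
  have hc' : ∀ φ : ℝ, r • (ρ • n + √(1 - ρ ^ 2) • (cos φ • Lambert.e₁ n + sin φ • Lambert.e₂ n)) =
      (r * ρ) • n + (r * √(1 - ρ ^ 2)) • (cos φ • Lambert.e₁ n + sin φ • Lambert.e₂ n) := fun φ => by
    module
  rcases le_or_gt (S * x - τ) 0 with hc | hc
  · -- no flip: `-c√(1-x²) = |c|√(1-x²) = r√(1-ρ²)`
    refine intervalIntegral.integral_congr fun φ _ => ?_
    rw [hv', hc', hT, abs_of_nonpos hc, neg_mul]
  · -- flip: `-c√(1-x²) = -r√(1-ρ²)`, azimuth `φ + π`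
    calc ∫ φ in (-π)..π, u (S • n - (S * x - τ) • (x • n + √(1 - x ^ 2) • (cos φ • Lambert.e₁ n + sin φ • Lambert.e₂ n)))
        = ∫ φ in (-π)..π, (fun a b : ℝ => u ((r * ρ) • n +
            ((S * x - τ) * √(1 - x ^ 2)) • (a • Lambert.e₁ n + b • Lambert.e₂ n))) (-cos φ) (-sin φ) := by
          refine intervalIntegral.integral_congr fun φ _ => ?_
          dsimp only
          rw [hv']
          congr 1
          module
      _ = ∫ φ in (-π)..π, (fun a b : ℝ => u ((r * ρ) • n +
            ((S * x - τ) * √(1 - x ^ 2)) • (a • Lambert.e₁ n + b • Lambert.e₂ n))) (cos φ) (sin φ) :=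
          intervalIntegral_comp_neg_cos_sin (fun a b : ℝ => u ((r * ρ) • n +
            ((S * x - τ) * √(1 - x ^ 2)) • (a • Lambert.e₁ n + b • Lambert.e₂ n)))
      _ = _ := by
          refine intervalIntegral.integral_congr fun φ _ => ?_
          dsimp only
          rw [hc', hT, abs_of_pos hc]

/-- **The radius and the cosine of the slice image**: for `x² ≤ 1` and reals `S, τ`, the explicit
`r = √(S² - (S x)² + τ²)`, `ρ = (S - (S x - τ) x)/r` satisfy `0 ≤ r`, `r² = S²(1 - x²) + τ²`, `r ρ = S - (S x - τ) x`
(also in the degenerate case `r = 0`, where `τ = 0`, `S(1 - x²) = 0` and `ρ = 0` by the junk value of division)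
and `ρ² ≤ 1` (`r² - (S - (S x - τ) x)² = (S x - τ)²(1 - x²) ≥ 0`). [folklore] -/
theorem trueSlice_radius_cosine {x : ℝ} (hx : x ^ 2 ≤ 1) (S τ : ℝ) :
    0 ≤ √(S ^ 2 - (S * x) ^ 2 + τ ^ 2) ∧
      √(S ^ 2 - (S * x) ^ 2 + τ ^ 2) ^ 2 = S ^ 2 * (1 - x ^ 2) + τ ^ 2 ∧
      √(S ^ 2 - (S * x) ^ 2 + τ ^ 2) * ((S - (S * x - τ) * x) / √(S ^ 2 - (S * x) ^ 2 + τ ^ 2)) = S - (S * x - τ) * x ∧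
      ((S - (S * x - τ) * x) / √(S ^ 2 - (S * x) ^ 2 + τ ^ 2)) ^ 2 ≤ 1 := by
  have hR0 : 0 ≤ S ^ 2 - (S * x) ^ 2 + τ ^ 2 := by nlinarith [mul_nonneg (sq_nonneg S) (sub_nonneg.2 hx), sq_nonneg τ]
  have hkey : (S - (S * x - τ) * x) ^ 2 ≤ S ^ 2 - (S * x) ^ 2 + τ ^ 2 := by
    have h : S ^ 2 - (S * x) ^ 2 + τ ^ 2 - (S - (S * x - τ) * x) ^ 2 = (S * x - τ) ^ 2 * (1 - x ^ 2) := by ring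
    nlinarith [mul_nonneg (sq_nonneg (S * x - τ)) (sub_nonneg.2 hx)]
  refine ⟨sqrt_nonneg _, by rw [sq_sqrt hR0]; ring, ?_, ?_⟩
  · rcases (sqrt_nonneg (S ^ 2 - (S * x) ^ 2 + τ ^ 2)).eq_or_lt with h0 | hpos
    · rw [← h0, zero_mul]
      have hR00 : S ^ 2 - (S * x) ^ 2 + τ ^ 2 = 0 := by rwa [eq_comm, sqrt_eq_zero hR0] at h0
      nlinarith [sq_nonneg (S - (S * x - τ) * x)]
    · exact mul_div_cancel₀ _ hpos.ne'
  · rw [div_pow, sq_sqrt hR0]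
    exact div_le_one_of_le₀ hkey hR0

/-- **The slice image is the circle of radius `r(x, τ)` at cosine `ρ(x, τ)`, explicit form**: for EVERY
`u : ℝ³ → ℝ`, every `n`, reals `S, τ` and `x ∈ [-1, 1]`, with `r = √(S² - (S x)² + τ²)`, `ρ = (S - (S x - τ) x)/r`:
`∫_{-π}^{π} u(S n - (S x - τ)(x n + √(1-x²)(cos φ e₁ n + sin φ e₂ n))) dφ = ∫_{-π}^{π} u(r [ρ n + √(1-ρ²)(cos φ e₁ n + sin φ e₂ n)]) dφ`. [folklore] -/
theorem circleIntegral_trueSlice (u : EuclideanSpace ℝ (Fin 3) → ℝ) (n : EuclideanSpace ℝ (Fin 3)) {x : ℝ}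
    (hx : x ∈ Icc (-1:ℝ) 1) (S τ : ℝ) :
    ∫ φ in (-π)..π, u (S • n - (S * x - τ) • (x • n + √(1 - x ^ 2) • (cos φ • Lambert.e₁ n + sin φ • Lambert.e₂ n))) =
      ∫ φ in (-π)..π, u (√(S ^ 2 - (S * x) ^ 2 + τ ^ 2) •
        (((S - (S * x - τ) * x) / √(S ^ 2 - (S * x) ^ 2 + τ ^ 2)) • n +
          √(1 - ((S - (S * x - τ) * x) / √(S ^ 2 - (S * x) ^ 2 + τ ^ 2)) ^ 2) •
            (cos φ • Lambert.e₁ n + sin φ • Lambert.e₂ n))) := by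
  have hx2 : x ^ 2 ≤ 1 := by nlinarith [hx.1, hx.2]
  obtain ⟨h0, _, h2, h3⟩ := trueSlice_radius_cosine hx2 S τ
  exact circleIntegral_trueSlice_of_sq_eq u n hx2 h0 (sq_sqrt (by nlinarith [mul_nonneg (sq_nonneg S) (sub_nonneg.2 hx2), sq_nonneg τ])) h2 h3

/-! ### The gain term as an average of circle integrals -/

/-- **The true gain term as a `(τ, x)`-average of circle integrals at one radius**: for `u` measurable of
Gaussian growth, unit `n` and real `S`, with `r(x, τ) = √(S² - (S x)² + τ²)`, `ρ(x, τ) = (S - (S x - τ) x)/r(x, τ)`: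
`gainTerm u (S n) = 2 ∫ γ(dτ) ∫_{-1}^{1} (S x - τ)₊ ∫_{-π}^{π} u( r [ρ n + √(1-ρ²)(cos φ e₁ n + sin φ e₂ n)] ) dφ dx`
(`gainTerm_true_eq_slice` and `circleIntegral_trueSlice` under the integral signs). [folklore] -/
theorem gainTerm_true_eq_circle (hn : ‖n‖ = 1) (hu : Measurable u)
    (hC : ∀ x : EuclideanSpace ℝ (Fin 3), |u x| ≤ C * Real.exp (‖x‖ ^ 2 / 4)) (S : ℝ) :
    gainTerm u (S • n) = 2 * ∫ τ, (∫ x in (-1:ℝ)..1, max (S * x - τ) 0 * ∫ φ in (-π)..π,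
      u (√(S ^ 2 - (S * x) ^ 2 + τ ^ 2) •
        (((S - (S * x - τ) * x) / √(S ^ 2 - (S * x) ^ 2 + τ ^ 2)) • n +
          √(1 - ((S - (S * x - τ) * x) / √(S ^ 2 - (S * x) ^ 2 + τ ^ 2)) ^ 2) •
            (cos φ • Lambert.e₁ n + sin φ • Lambert.e₂ n)))) ∂gaussianReal 0 1 := by
  rw [gainTerm_true_eq_slice hn hu hC S]
  congr 1
  refine integral_congr_ae (Eventually.of_forall fun τ => ?_)
  refine intervalIntegral.integral_congr fun x hx => ?_
  rw [uIcc_of_le (by norm_num)] at hx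
  rw [circleIntegral_trueSlice u n hx S τ]

/-- **The slice `τ = 0` is FACT F verbatim**: for `u` measurable of Gaussian growth, unit `n` and `0 ≤ S`,
`lorentzGain u (S n) = 2 ∫_{-1}^{1} (S x)₊ ∫_{-π}^{π} u( (S z) [z n + √(1-z²)(cos φ e₁ n + sin φ e₂ n)] )|_{z = √(1-x²)} dφ dx`
— the Lorentz image circle has radius `S z` and cosine `z = √(1-x²)` (radius ratio = cosine), the integrand of
`t12_lorentzGain_circleAvg` (`= πS ∫₀¹ 4z (2π)⁻¹ ∫ u((Sz)(…)) dφ dz`, the same number after `x dx = -z dz`). [folklore] -/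
theorem lorentzGain_true_eq_circle_zero (hn : ‖n‖ = 1) (hu : Measurable u)
    (hC : ∀ x : EuclideanSpace ℝ (Fin 3), |u x| ≤ C * Real.exp (‖x‖ ^ 2 / 4)) {S : ℝ} (hS : 0 ≤ S) :
    lorentzGain u (S • n) = 2 * ∫ x in (-1:ℝ)..1, max (S * x) 0 * ∫ φ in (-π)..π,
      u ((S * √(1 - x ^ 2)) • (√(1 - x ^ 2) • n +
        √(1 - √(1 - x ^ 2) ^ 2) • (cos φ • Lambert.e₁ n + sin φ • Lambert.e₂ n))) := by
  rw [lorentzGain_true_eq_slice_zero hn hu hC S]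
  congr 1
  refine intervalIntegral.integral_congr fun x hx => ?_
  rw [uIcc_of_le (by norm_num)] at hx
  have hx2 : x ^ 2 ≤ 1 := by nlinarith [hx.1, hx.2]
  have hz : √(1 - x ^ 2) ^ 2 = 1 - x ^ 2 := sq_sqrt (by linarith)
  have h := circleIntegral_trueSlice_of_sq_eq u n (S := S) (τ := 0) (r := S * √(1 - x ^ 2)) (ρ := √(1 - x ^ 2)) hx2
    (mul_nonneg hS (sqrt_nonneg _)) (by rw [mul_pow, hz]; ring) (by rw [mul_assoc, ← pow_two, hz]; ring)
    (by rw [hz]; nlinarith [sq_nonneg x])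
  rw [sub_zero] at h
  rw [h]

/-- Gaussian growth implies boundedness on bounded sets: `|u x| ≤ C e^{R²/4}` for `‖x‖ ≤ R` (the hypothesis of
FACT F, `t12_lorentzGain_circleAvg`). [folklore] -/
theorem exists_bound_on_ball_of_gaussGrowth (hC : ∀ x : EuclideanSpace ℝ (Fin 3), |u x| ≤ C * Real.exp (‖x‖ ^ 2 / 4))
    (R : ℝ) : ∃ C' : ℝ, ∀ x : EuclideanSpace ℝ (Fin 3), ‖x‖ ≤ R → |u x| ≤ C' :=
  ⟨C * Real.exp (R ^ 2 / 4), fun x hx => (hC x).trans (mul_le_mul_of_nonneg_left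
    (Real.exp_le_exp.2 (by nlinarith [norm_nonneg x])) (nonneg_of_gaussGrowth_euclidean hC))⟩

/-- **The slice `τ = 0` against FACT F, as numbers**: for `u` measurable of Gaussian growth, unit `n` and `0 ≤ S`,
`2 ∫_{-1}^{1} (S x)₊ ∫_{-π}^{π} u((S z)(z n + √(1-z²)(…)))|_{z = √(1-x²)} dφ dx = πS ∫₀¹ 4z (2π)⁻¹ ∫_{-π}^{π} u((S z)(z n + √(1-z²)(…))) dφ dz`
— the height `x` of the impact direction with the flux `(S x)₊ dx` and the image cosine `z = √(1-x²)` with FACT F's law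
`2S z dz` parametrise the same Lorentz step (`x dx = -z dz`; both sides are `lorentzGain u (S n)`,
`lorentzGain_true_eq_circle_zero` and `lorentzGain_smul_eq_circleAvg`). [folklore] -/
theorem trueSlice_zero_eq_lorentzCircleAvg (hn : ‖n‖ = 1) (hu : Measurable u)
    (hC : ∀ x : EuclideanSpace ℝ (Fin 3), |u x| ≤ C * Real.exp (‖x‖ ^ 2 / 4)) {S : ℝ} (hS : 0 ≤ S) :
    2 * ∫ x in (-1:ℝ)..1, max (S * x) 0 * ∫ φ in (-π)..π,
        u ((S * √(1 - x ^ 2)) • (√(1 - x ^ 2) • n +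
          √(1 - √(1 - x ^ 2) ^ 2) • (cos φ • Lambert.e₁ n + sin φ • Lambert.e₂ n))) =
      π * S * ∫ z in (0:ℝ)..1, 4 * z * ((2 * π)⁻¹ * ∫ φ in (-π)..π,
        u ((S * z) • (z • n + √(1 - z ^ 2) • (cos φ • Lambert.e₁ n + sin φ • Lambert.e₂ n)))) := by
  rw [← lorentzGain_true_eq_circle_zero hn hu hC hS,
    lorentzGain_smul_eq_circleAvg hn hS hu (exists_bound_on_ball_of_gaussGrowth hC)]

/-! ### Registered helpers -/

/-- **Registered helper `t12_trueSlice_circle` — the circle geometry of the true collision step.** For EVERY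
`u : ℝ³ → ℝ`, every `n ∈ ℝ³`, reals `S, τ` and `x ∈ [-1, 1]`, put `r := √(S² - (S x)² + τ²)` and
`ρ := (S - (S x - τ) x)/r` (frame `Lambert.e₁/e₂`). Then `r² = S²(1 - x²) + τ²`, `r ρ = S - (S x - τ) x`, `|ρ| ≤ 1`, and
`∫_{-π}^{π} u( S n - (S x - τ)(x n + √(1-x²)(cos φ e₁ n + sin φ e₂ n)) ) dφ = ∫_{-π}^{π} u( r [ρ n + √(1-ρ²)(cos φ e₁ n + sin φ e₂ n)] ) dφ`:
as the azimuth `φ` of the impact direction varies at fixed height `x` and partner projection `τ`, the own outgoing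
velocity `S n - (S x - τ) ω(x, φ)` of `t12_gainTerm_true_slice` runs over the CIRCLE of the sphere of radius
`r(x, τ)` at cosine `ρ(x, τ)` about the current direction `n` (for unit `n`: `‖v'‖² = S² - (S x)² + τ²` and
`⟪v', n⟫ = S - (S x - τ) x` are `φ`-independent; transverse part `-(S x - τ)√(1-x²) = ∓ r√(1-ρ²)`, azimuth `φ + π`
or `φ` — the flip is a full-period shift, `intervalIntegral_comp_neg_cos_sin`), so the inner integral of the true
slice is `2π` times the circle average `(A_ρ u(r ·))(n)` of FACT F. [folklore] -/
theorem t12_trueSlice_circle : ∀ (u : EuclideanSpace ℝ (Fin 3) → ℝ) (n : EuclideanSpace ℝ (Fin 3)) (S x τ : ℝ), x ∈ Set.Icc (-1:ℝ) 1 → Real.sqrt (S ^ 2 - (S * x) ^ 2 + τ ^ 2) ^ 2 = S ^ 2 * (1 - x ^ 2) + τ ^ 2 ∧ Real.sqrt (S ^ 2 - (S * x) ^ 2 + τ ^ 2) * ((S - (S * x - τ) * x) / Real.sqrt (S ^ 2 - (S * x) ^ 2 + τ ^ 2)) = S - (S * x - τ) * x ∧ |(S - (S * x - τ) * x) / Real.sqrt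 (S ^ 2 - (S * x) ^ 2 + τ ^ 2)| ≤ 1 ∧ ∫ φ in (-Real.pi)..Real.pi, u (S • n - (S * x - τ) • (x • n + Real.sqrt (1 - x ^ 2) • (Real.cos φ • Literature.Analysis.FluidPDE.Lambert.e₁ n + Real.sin φ • Literature.Analysis.FluidPDE.Lambert.e₂ n))) = ∫ φ in (-Real.pi)..Real.pi, u (Real.sqrt (S ^ 2 - (S * x) ^ 2 + τ ^ 2) • (((S - (S * x - τ) * x) / Real.sqrt (S ^ 2 - (S * x) ^ 2 + τ ^ 2)) • n + Real.sqrt (1 - ((S - (S * x - τ) * x) / Real.sqrt (S ^ 2 - (S * x) ^ 2 + τ ^ 2)) ^ 2) • (Real.cos φ • Literature.Analysis.FluidPDE.Lambert.e₁ n + Real.sin φ • Literature.Analysis.FluidPDE.Lambert.e₂ n))) := by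
  intro u n S x τ hx
  have hx2 : x ^ 2 ≤ 1 := by nlinarith [hx.1, hx.2]
  obtain ⟨_, h1, h2, h3⟩ := trueSlice_radius_cosine hx2 S τ
  exact ⟨h1, h2, (sq_le_one_iff_abs_le_one _).1 h3, circleIntegral_trueSlice u n hx S τ⟩

/-- **Registered helper `t12_gainTerm_true_circleAvg` — the TRUE one-step gain term on a general test function as a
`(τ, x)`-average of CIRCLE integrals at one radius.** For `u : ℝ³ → ℝ` measurable of Gaussian growth
`|u x| ≤ C e^{‖x‖²/4}`, a unit vector `n` and every real `S` (`γ = gaussianReal 0 1`, frame `Lambert.e₁/e₂`,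
`r(x, τ) = √(S² - (S x)² + τ²)`, `ρ(x, τ) = (S - (S x - τ) x)/r(x, τ)` written out):
`gainTerm u (S n) = 2 ∫ γ(dτ) ∫_{-1}^{1} (S x - τ)₊ ∫_{-π}^{π} u( r(x,τ) [ρ(x,τ) n + √(1-ρ(x,τ)²)(cos φ e₁ n + sin φ e₂ n)] ) dφ dx`
— one TRUE collision step (Maxwellian partner) evaluates `u` on circles at ONE radius `r(x, τ)` with the zonal angular
operator `A_{ρ(x,τ)}` about the current direction, averaged over the flux `(S x - τ)₊ dx` and the Gaussian partner
projection `γ(dτ)`; the slice `τ = 0` (`r = S√(1-x²)`, `ρ = √(1-x²)`: radius ratio = cosine) is the Lorentz operator of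
FACT F (`lorentzGain_true_eq_circle_zero`, `t12_lorentzGain_circleAvg`). Composition of such steps gives the true `k`-fold
iterate as an average of compositions of circle averages at one final radius (step (1) of §6 of the plan).
(`t12_gainTerm_true_slice` + `t12_trueSlice_circle`.) [folklore] -/
theorem t12_gainTerm_true_circleAvg : ∀ (u : EuclideanSpace ℝ (Fin 3) → ℝ) (C : ℝ), Measurable u → (∀ x : EuclideanSpace ℝ (Fin 3), |u x| ≤ C * Real.exp (‖x‖ ^ 2 / 4)) → ∀ n : EuclideanSpace ℝ (Fin 3), ‖n‖ = 1 → ∀ S : ℝ, Summit.AtomisticToContinuum.HydrodynamicLimit.Theorems.ClampedCorrectorBirth.gainTerm u (S • n) = 2 * ∫ τ, (∫ x in (-1:ℝ)..1, max (S * x - τ) 0 * ∫ φ in (-Real.pi)..Real.pi, u (Real.sqrt (S ^ 2 - (S * x) ^ 2 + τ ^ 2) • (((S - (S * x - τ) * x) / Real.sqrt (S ^ 2 - (S * x) ^ 2 + τ ^ 2)) • n + Real.sqrt (1 - ((S - (S * x - τ) * x) / Real.sqrt (S ^ 2 - (S * x) ^ 2 + τ ^ 2)) ^ 2) • (Real.cos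 φ • Literature.Analysis.FluidPDE.Lambert.e₁ n + Real.sin φ • Literature.Analysis.FluidPDE.Lambert.e₂ n)))) ∂ProbabilityTheory.gaussianReal 0 1 :=
  fun _ _ hu hC _ hn S => gainTerm_true_eq_circle hn hu hC S

end Summit.AtomisticToContinuum.HydrodynamicLimit.Theorems.ClampedCorrectorBirth

end
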